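import Literature.NumberTheory.DiophantineGeometry.AbcShapeMoments
import Literature.NumberTheory.DiophantineGeometry.AbcShapeReduction
import Literature.NumberTheory.DiophantineGeometry.FourierPositivityCount
import HarnessLib

/-!
# The fourth-moment bound for shape values (Bernert, Prop. 3, (3.2))

For the value family `U = (c ∏ᵢ xᵢ^{i+1})_{x ∈ box X}` and a coordinate `j` carrying an exponent
`j + 1 ≥ 2`, we prove the additive-energy bound of [Bernert2025, proof of Prop. 3, (3.2)]
(`∫ |S₁|⁴ ≪ X^ε (X₁⋯X_d)³ / X_j`) in the explicit form

> `E₄(U) ≤ 3 D^{d} · (#box)² · ∏_{i ≠ j} Xᵢ` (`AbcShapes.energy4_le`),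

where `D` is any bound for the number of divisors of the integers `≤ c ∏ (2Xᵢ)^{i+1}`. The
proof is the printed one: Cauchy–Schwarz in the variables `xᵢ, i ≠ j` inside `|S₁|²` and
orthogonality — here the combinatorial lemma `FourierCount.card_filter_add_eq_add_le` — reduce
`E₄` to `#{x_{i≠j}} ·` the number of solutions of
`u(y) - u(y') = c A(r) (s'^{j+1} - s^{j+1})`; the diagonal `s = s'` contributes
`#{r} #{s} E₂(U) ≤ #box² D^d` (second moment, `energy2_le`), and for `s ≠ s'` one fixes `y, y'`
(`#box²` ways), after which `r` is restricted to tuples of divisors of `n = u(y) - u(y')`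
(`≤ τ(|n|)^{d-1}`) and `(s, s')` is determined by the divisor `s' - s` of `n` (`≤ 2τ(|n|)`), the
map `s ↦ (s + δ)^{e} - s^{e}` being strictly increasing for `e ≥ 2` (this is where `j ≥ 1` is
needed, as in the source).

## References

* [Bernert2025] C. Bernert, *The exceptional set in the abc conjecture*, arXiv:2506.13364 (2025),
  proof of Proposition 3, (3.2).
* [BernertEtAl2024] C. Bernert, T. Browning, J. D. Lichtman, J. Teräväinen, *Bounds on the
  exceptional set in the abc conjecture*, arXiv:2410.12234, proof of Proposition 3.1 (v1), (3.6).
-/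

noncomputable section

open Finset

namespace Literature.NumberTheory.DiophantineGeometry

namespace AbcShapes

/-! ### Splitting off the coordinate `j` -/

/-- The cofactor `A_j(r) = ∏ᵢ rᵢ^{(succAbove j i) + 1}` of the `j`-th variable in a shape value.
[cite: Bernert2025, Proposition 3] -/
def coShapeVal {d' : ℕ} (j : Fin (d' + 1)) (r : Fin d' → ℕ) : ℕ :=
  ∏ i, r i ^ ((j.succAbove i : ℕ) + 1)

/-- `∏ᵢ xᵢ^{i+1} = s^{j+1} · A_j(r)` for `x = insertNth j s r`. [folklore] -/
theorem shapeVal_insertNth {d' : ℕ} (j : Fin (d' + 1)) (s : ℕ) (r : Fin d' → ℕ) :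
    shapeVal (Fin.insertNth j s r) = s ^ ((j : ℕ) + 1) * coShapeVal j r := by
  rw [shapeVal, Fin.prod_univ_succAbove _ j, Fin.insertNth_apply_same, coShapeVal]
  congr 1
  exact Fintype.prod_congr _ _ fun i => by rw [Fin.insertNth_apply_succAbove]

/-- `A_j(r) > 0` for positive `r`. [folklore] -/
theorem coShapeVal_pos {d' : ℕ} (j : Fin (d' + 1)) {r : Fin d' → ℕ} (hr : ∀ i, 0 < r i) :
    0 < coShapeVal j r :=
  prod_pos fun i _ => pow_pos (hr i) _

/-- Each `rᵢ` divides `A_j(r)`. [folklore] -/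
theorem dvd_coShapeVal {d' : ℕ} (j : Fin (d' + 1)) (r : Fin d' → ℕ) (i : Fin d') :
    r i ∣ coShapeVal j r :=
  (dvd_pow_self (r i) (Nat.succ_ne_zero _)).trans
    (dvd_prod_of_mem (fun i => r i ^ ((j.succAbove i : ℕ) + 1)) (mem_univ i))

/-- Removing the `j`-th coordinate maps the box to the box of the remaining parameters.
[folklore] -/
theorem removeNth_mem_dyadicBox {d' : ℕ} (j : Fin (d' + 1)) {X x : Fin (d' + 1) → ℕ}
    (h : x ∈ dyadicBox X) : j.removeNth x ∈ dyadicBox (j.removeNth X) := by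
  rw [mem_dyadicBox] at h ⊢
  exact fun i => h (j.succAbove i)

/-- Tuples `r` in a finite set with `F r ∣ m`, where every coordinate divides `F r`, number at
most `τ(m)^{d'}` (`m ≠ 0`). [folklore] -/
theorem card_filter_dvd_le {d' : ℕ} (B : Finset (Fin d' → ℕ)) (F : (Fin d' → ℕ) → ℕ)
    (hF : ∀ r i, r i ∣ F r) {m : ℕ} (hm : m ≠ 0) :
    (B.filter (fun r => F r ∣ m)).card ≤ m.divisors.card ^ d' := by
  classical
  calc (B.filter (fun r => F r ∣ m)).card
      ≤ (Fintype.piFinset fun _ : Fin d' => m.divisors).card := by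
        refine card_le_card fun r hr => ?_
        obtain ⟨-, hrm⟩ := mem_filter.mp hr
        exact Fintype.mem_piFinset.mpr fun i => Nat.mem_divisors.mpr ⟨(hF r i).trans hrm, hm⟩
    _ = m.divisors.card ^ d' := by
        rw [Fintype.card_piFinset, prod_const, card_univ, Fintype.card_fin]

/-! ### Power differences `(s + δ)^e - s^e` -/

/-- For `e ≥ 2` and `δ > 0`, `s ↦ (s + δ)^e - s^e` is strictly increasing on `ℕ`
(`= δ Σᵢ (s+δ)^i s^{e-1-i}`). This fails for `e = 1`, as in the source. [folklore] -/
theorem pow_add_sub_pow_strictMono {e : ℕ} (he : 2 ≤ e) {δ : ℤ} (hδ : 0 < δ) :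
    StrictMono (fun s : ℕ => ((s : ℤ) + δ) ^ e - (s : ℤ) ^ e) := by
  intro s s' hss'
  have key : ∀ t : ℕ, ((t : ℤ) + δ) ^ e - (t : ℤ) ^ e =
      (∑ i ∈ range e, ((t : ℤ) + δ) ^ i * (t : ℤ) ^ (e - 1 - i)) * δ := by
    intro t
    rw [← geom_sum₂_mul, add_sub_cancel_left]
  simp only [key]
  refine mul_lt_mul_of_pos_right (sum_lt_sum (fun i _ => ?_) ⟨0, mem_range.mpr (by omega), ?_⟩) hδ
  · have hs : (s : ℤ) ≤ s' := by exact_mod_cast hss'.le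
    exact mul_le_mul (pow_le_pow_left₀ (by positivity) (by linarith) i)
      (pow_le_pow_left₀ (by positivity) hs _) (by positivity) (by positivity)
  · simp only [pow_zero, one_mul, Nat.sub_zero]
    exact pow_lt_pow_left₀ (by exact_mod_cast hss') (by positivity) (by omega)

/-- **Pairs with a prescribed power difference**: for `e ≥ 2`, `K ≠ 0` and `n ≠ 0`, the pairs
`(s, s')` of natural numbers in a finite set with `s ≠ s'` and `K (s'^e - s^e) = n` number at
most `2τ(|n|)`: `δ = s' - s` is a nonzero divisor of `n` and determines the pair
(`pow_add_sub_pow_strictMono`). [cite: BernertEtAl2024, Proposition 3.1] -/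
theorem card_pairs_pow_sub_pow_le {e : ℕ} (he : 2 ≤ e) {K : ℤ} (hK : K ≠ 0) {n : ℤ} (hn : n ≠ 0)
    (BS : Finset ℕ) :
    ((BS ×ˢ BS).filter (fun p => p.1 ≠ p.2 ∧
        K * (((p.2 : ℕ) : ℤ) ^ e - ((p.1 : ℕ) : ℤ) ^ e) = n)).card ≤ 2 * n.natAbs.divisors.card := by
  classical
  set Dv := n.natAbs.divisors with hDv
  set T : Finset ℤ := Dv.image (fun m : ℕ => (m : ℤ)) ∪ Dv.image (fun m : ℕ => -(m : ℤ)) with hT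
  have hTcard : T.card ≤ 2 * Dv.card :=
    (card_union_le _ _).trans (by rw [two_mul]; exact add_le_add card_image_le card_image_le)
  refine le_trans ?_ hTcard
  refine card_le_card_of_injOn (fun p => ((p.2 : ℕ) : ℤ) - ((p.1 : ℕ) : ℤ)) (fun p hp => ?_)
    (fun p hp p' hp' h => ?_)
  · obtain ⟨-, hne, heq⟩ := mem_filter.mp (mem_coe.mp hp)
    have hδn : ((p.2 : ℕ) : ℤ) - ((p.1 : ℕ) : ℤ) ∣ n := by
      rw [← heq]; exact (sub_dvd_pow_sub_pow _ _ e).mul_left K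
    have hδ0 : ((p.2 : ℕ) : ℤ) - ((p.1 : ℕ) : ℤ) ≠ 0 := by
      intro h0; exact hne (by exact_mod_cast (sub_eq_zero.mp h0).symm)
    have hmem : (((p.2 : ℕ) : ℤ) - ((p.1 : ℕ) : ℤ)).natAbs ∈ Dv :=
      Nat.mem_divisors.mpr ⟨Int.natAbs_dvd_natAbs.mpr hδn, Int.natAbs_ne_zero.mpr hn⟩
    rw [mem_coe, hT, mem_union, mem_image, mem_image]
    rcases Int.natAbs_eq (((p.2 : ℕ) : ℤ) - ((p.1 : ℕ) : ℤ)) with h1 | h1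
    · exact Or.inl ⟨_, hmem, h1.symm⟩
    · exact Or.inr ⟨_, hmem, h1.symm⟩
  · obtain ⟨-, hne, heq⟩ := mem_filter.mp (mem_coe.mp hp)
    obtain ⟨-, hne', heq'⟩ := mem_filter.mp (mem_coe.mp hp')
    have hdiff : ((p.2 : ℕ) : ℤ) ^ e - ((p.1 : ℕ) : ℤ) ^ e =
        ((p'.2 : ℕ) : ℤ) ^ e - ((p'.1 : ℕ) : ℤ) ^ e :=
      mul_left_cancel₀ hK (heq.trans heq'.symm)
    set δ : ℤ := ((p.2 : ℕ) : ℤ) - ((p.1 : ℕ) : ℤ) with hδ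
    have hδ' : ((p'.2 : ℕ) : ℤ) - ((p'.1 : ℕ) : ℤ) = δ := h.symm
    rcases lt_trichotomy δ 0 with hneg | hzero | hpos
    · -- `δ < 0`: `p.1 = p.2 + (-δ)`, compare via `s' ↦ (s' + (-δ))^e - s'^e`
      have hmono := pow_add_sub_pow_strictMono he (neg_pos.mpr hneg)
      have h2 : p.2 = p'.2 := by
        apply hmono.injective
        simp only
        have e1 : ((p.2 : ℕ) : ℤ) + -δ = p.1 := by rw [hδ]; ring
        have e2 : ((p'.2 : ℕ) : ℤ) + -δ = p'.1 := by rw [← hδ']; ring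
        rw [e1, e2]; linarith
      have h1 : ((p.1 : ℕ) : ℤ) = p'.1 := by
        have := hδ'; rw [hδ, h2] at this; linarith
      exact Prod.ext (by exact_mod_cast h1) h2
    · exact absurd (by exact_mod_cast (sub_eq_zero.mp hzero).symm) hne
    · have hmono := pow_add_sub_pow_strictMono he hpos
      have h1 : p.1 = p'.1 := by
        apply hmono.injective
        simp only
        have e1 : ((p.1 : ℕ) : ℤ) + δ = p.2 := by rw [hδ]; ring
        have e2 : ((p'.1 : ℕ) : ℤ) + δ = p'.2 := by rw [← hδ']; ring
        rw [e1, e2]; linarith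
      have h2 : ((p.2 : ℕ) : ℤ) = p'.2 := by
        have := hδ'; rw [hδ, h1] at this; linarith
      exact Prod.ext h1 (by exact_mod_cast h2)

/-! ### The fourth moment -/

/-- **Fourth-moment bound** [Bernert2025, (3.2)]: let `c ≥ 1`, `X` a box with positive
parameters, `j` a coordinate with `j ≥ 1` (exponent `j + 1 ≥ 2`), and `D` a bound for the number
of divisors of every `1 ≤ m ≤ c ∏ (2Xᵢ)^{i+1}`. Then
`E₄(U) ≤ 3 D^{d} · (#box X)² · ∏_{i ≠ j} Xᵢ` for `U = (c ∏ xᵢ^{i+1})_{x ∈ box X}`, i.e.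
`E₄ ≪ X^ε N³/X_j` with `N = #box X = ∏ Xᵢ`. [cite: Bernert2025, Proposition 3] -/
theorem energy4_le {d' : ℕ} {c : ℕ} (hc : 0 < c) (X : Fin (d' + 1) → ℕ) (hX : ∀ i, 0 < X i)
    (j : Fin (d' + 1)) (hj : 1 ≤ (j : ℕ)) {D : ℕ}
    (hD : ∀ m : ℕ, m ≠ 0 → m ≤ c * shapeVal (fun i => 2 * X i) → m.divisors.card ≤ D) :
    energy4 c X ≤ 3 * D ^ (d' + 1) * (dyadicBox X).card ^ 2 * ∏ i : Fin d', X (j.succAbove i) := by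
  classical
  -- notation
  set box := dyadicBox X with hbox
  set BR : Finset (Fin d' → ℕ) := dyadicBox (j.removeNth X) with hBR
  set BS : Finset ℕ := Ico (X j) (2 * X j) with hBS
  set φ : (Fin (d' + 1) → ℕ) → ℤ := vals c with hφ
  set ψ : (Fin d' → ℕ) → ℕ → ℤ := fun r s => vals c (Fin.insertNth j s r) with hψ
  set e : ℕ := (j : ℕ) + 1 with he
  have he2 : 2 ≤ e := by omega
  have hBRcard : BR.card = ∏ i : Fin d', X (j.succAbove i) := by
    rw [hBR, card_dyadicBox]; rfl
  have hBScard : BS.card = X j := by rw [hBS, Nat.card_Ico]; omega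
  have hNsplit : box.card = BR.card * BS.card := by
    rw [hbox, card_dyadicBox, Fin.prod_univ_succAbove _ j, hBRcard, hBScard, mul_comm]
  -- values on the box are positive multiples bounded by `c · shapeVal (2X)`
  have hval_le : ∀ y ∈ box, c * shapeVal y ≤ c * shapeVal (fun i => 2 * X i) := fun y hy =>
    Nat.mul_le_mul_left _ (shapeVal_mono fun i => ((mem_dyadicBox.mp hy) i).2.le)
  have hψ_eq : ∀ (r : Fin d' → ℕ) (s : ℕ), ψ r s = (c : ℤ) * coShapeVal j r * (s : ℤ) ^ e := by
    intro r s
    simp only [hψ, vals, shapeVal_insertNth]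
    push_cast; ring
  /- Step 1: `E₄ ≤` the left-hand side of the fibring lemma -/
  have h1 : energy4 c X ≤ (((box ×ˢ (BR ×ˢ BS)) ×ˢ (box ×ˢ (BR ×ˢ BS))).filter
      (fun t => φ t.1.1 + ψ t.1.2.1 t.1.2.2 = φ t.2.1 + ψ t.2.2.1 t.2.2.2)).card := by
    rw [energy4, mixedEnergy, coinc]
    refine card_le_card_of_injOn
      (fun t => ((t.1.1, (j.removeNth t.1.2, t.1.2 j)), (t.2.1, (j.removeNth t.2.2, t.2.2 j))))
      (fun t ht => ?_) (fun t ht t' ht' h => ?_)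
    · obtain ⟨hmem, heq⟩ := mem_filter.mp (mem_coe.mp ht)
      simp only [mem_product] at hmem
      obtain ⟨⟨hx, hy⟩, hx', hy'⟩ := hmem
      refine mem_coe.mpr (mem_filter.mpr ⟨?_, ?_⟩)
      · simp only [mem_product]
        exact ⟨⟨hx, removeNth_mem_dyadicBox j hy, (mem_dyadicBox.mp hy) j |> fun h =>
          mem_Ico.mpr h⟩, hx', removeNth_mem_dyadicBox j hy',
          (mem_dyadicBox.mp hy') j |> fun h => mem_Ico.mpr h⟩
      · simp only [hψ, hφ, Fin.insertNth_self_removeNth]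
        exact heq
    · simp only [Prod.mk.injEq] at h
      obtain ⟨⟨h11, h12, h13⟩, h21, h22, h23⟩ := h
      have hy : t.1.2 = t'.1.2 := by
        rw [← Fin.insertNth_self_removeNth j t.1.2, ← Fin.insertNth_self_removeNth j t'.1.2,
          h12, h13]
      have hy' : t.2.2 = t'.2.2 := by
        rw [← Fin.insertNth_self_removeNth j t.2.2, ← Fin.insertNth_self_removeNth j t'.2.2,
          h22, h23]
      exact Prod.ext (Prod.ext h11 hy) (Prod.ext h21 hy')
  /- Step 2: the fibring lemma -/
  have h2 := FourierCount.card_filter_add_eq_add_le box BR BS φ ψ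
  set NN := (BR ×ˢ ((box ×ˢ BS) ×ˢ (box ×ˢ BS))).filter
    (fun t => φ t.2.1.1 + ψ t.1 t.2.1.2 = φ t.2.2.1 + ψ t.1 t.2.2.2) with hNN
  /- Step 3: diagonal `s = s'` -/
  have h3 : (NN.filter (fun t => t.2.1.2 = t.2.2.2)).card ≤ BR.card * BS.card * energy2 c X := by
    rw [energy2, coinc, ← card_product, ← card_product]
    refine card_le_card_of_injOn (fun t => ((t.1, t.2.1.2), (t.2.1.1, t.2.2.1)))
      (fun t ht => ?_) (fun t ht t' ht' h => ?_)
    · obtain ⟨hN, hss⟩ := mem_filter.mp (mem_coe.mp ht)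
      obtain ⟨hmem, heq⟩ := mem_filter.mp hN
      simp only [mem_product] at hmem
      obtain ⟨hr, ⟨hy, hs⟩, hy', hs'⟩ := hmem
      refine mem_coe.mpr (mem_product.mpr ⟨mem_product.mpr ⟨hr, hs⟩, mem_filter.mpr
        ⟨mem_product.mpr ⟨hy, hy'⟩, ?_⟩⟩)
      rw [hss] at heq
      simpa [hφ] using heq
    · obtain ⟨-, hss⟩ := mem_filter.mp (mem_coe.mp ht)
      obtain ⟨-, hss'⟩ := mem_filter.mp (mem_coe.mp ht')
      simp only [Prod.mk.injEq] at h
      obtain ⟨⟨hr, hs⟩, hy, hy'⟩ := h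
      refine Prod.ext hr (Prod.ext (Prod.ext hy hs) (Prod.ext hy' ?_))
      rw [← hss, ← hss', hs]
  /- Step 4: off-diagonal `s ≠ s'`, fibred over `(y, y')` -/
  have h4 : (NN.filter (fun t => ¬ t.2.1.2 = t.2.2.2)).card ≤ box.card ^ 2 * (2 * D ^ (d' + 1)) := by
    rw [card_eq_sum_card_fiberwise (f := fun t => (t.2.1.1, t.2.2.1)) (t := box ×ˢ box)
      (fun t ht => by
        obtain ⟨hN, -⟩ := mem_filter.mp (mem_coe.mp ht)
        have hmem := (mem_filter.mp hN).1
        simp only [mem_product] at hmem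
        exact mem_coe.mpr (mem_product.mpr ⟨hmem.2.1.1, hmem.2.2.1⟩))]
    rw [sq, ← card_product]
    refine (sum_le_sum (fun yy hyy => ?_)).trans (by rw [sum_const, smul_eq_mul])
    obtain ⟨y, y'⟩ := yy
    obtain ⟨hy, hy'⟩ := mem_product.mp hyy
    set n : ℤ := φ y - φ y' with hn
    -- the fibre over `(y, y')`
    set F := (NN.filter (fun t => ¬ t.2.1.2 = t.2.2.2)).filter (fun t => (t.2.1.1, t.2.2.1) = (y, y'))
      with hF
    have hFmem : ∀ t ∈ F, t.1 ∈ BR ∧ t.2.1.2 ∈ BS ∧ t.2.2.2 ∈ BS ∧ t.2.1.1 = y ∧ t.2.2.1 = y' ∧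
        t.2.1.2 ≠ t.2.2.2 ∧
        (c : ℤ) * coShapeVal j t.1 * ((t.2.2.2 : ℤ) ^ e - (t.2.1.2 : ℤ) ^ e) = n := by
      intro t ht
      obtain ⟨ht1, hyy'⟩ := mem_filter.mp ht
      obtain ⟨hN, hne⟩ := mem_filter.mp ht1
      obtain ⟨hmem, heq⟩ := mem_filter.mp hN
      simp only [mem_product] at hmem
      simp only [Prod.mk.injEq] at hyy'
      obtain ⟨rfl, rfl⟩ := hyy'
      refine ⟨hmem.1, hmem.2.1.2, hmem.2.2.2, rfl, rfl, hne, ?_⟩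
      rw [hψ_eq, hψ_eq] at heq
      rw [hn]
      linear_combination (-1 : ℤ) * heq
    rcases eq_or_ne n 0 with hn0 | hn0
    · -- `n = 0` forces `s = s'`: the fibre is empty
      have hFe : F = ∅ := by
        refine eq_empty_of_forall_notMem fun t ht => ?_
        obtain ⟨hr, -, -, -, -, hne, heq⟩ := hFmem t ht
        rw [hn0] at heq
        have hA : (c : ℤ) * coShapeVal j t.1 ≠ 0 := by
          have hrpos : ∀ i, 0 < t.1 i := fun i => by
            have h := (mem_dyadicBox.mp hr) i
            have hXi : 0 < j.removeNth X i := hX _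
            omega
          have := coShapeVal_pos j hrpos
          positivity
        have hpow : (t.2.2.2 : ℤ) ^ e = (t.2.1.2 : ℤ) ^ e := by
          have := (mul_eq_zero.mp heq).resolve_left hA; linarith
        have : t.2.2.2 = t.2.1.2 := Nat.pow_left_injective (by omega : e ≠ 0) (by exact_mod_cast hpow)
        exact hne this.symm
      rw [hFe, card_empty]; exact Nat.zero_le _
    · -- `n ≠ 0`: fibre over `r`, which is confined to divisor tuples of `|n|`
      have hnD : n.natAbs.divisors.card ≤ D := by
        refine hD _ (Int.natAbs_ne_zero.mpr hn0) ?_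
        have h0y : (0 : ℤ) ≤ φ y := by simp only [hφ, vals]; positivity
        have h0y' : (0 : ℤ) ≤ φ y' := by simp only [hφ, vals]; positivity
        have hy1 : φ y ≤ (c * shapeVal (fun i => 2 * X i) : ℕ) := by
          simp only [hφ, vals]; exact_mod_cast hval_le y hy
        have hy2 : φ y' ≤ (c * shapeVal (fun i => 2 * X i) : ℕ) := by
          simp only [hφ, vals]; exact_mod_cast hval_le y' hy'
        have : (n.natAbs : ℤ) ≤ (c * shapeVal (fun i => 2 * X i) : ℕ) := by
          rw [Int.natCast_natAbs, hn, abs_le]; constructor <;> linarith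
        exact_mod_cast this
      set BRn := BR.filter (fun r => coShapeVal j r ∣ n.natAbs) with hBRn
      have hBRn : BRn.card ≤ D ^ d' :=
        (card_filter_dvd_le BR (coShapeVal j) (dvd_coShapeVal j) (Int.natAbs_ne_zero.mpr hn0)).trans
          (Nat.pow_le_pow_left hnD d')
      rw [card_eq_sum_card_fiberwise (f := fun t => t.1) (s := F) (t := BRn) (fun t ht => by
        obtain ⟨hr, -, -, -, -, -, heq⟩ := hFmem t (mem_coe.mp ht)
        refine mem_coe.mpr (mem_filter.mpr ⟨hr, ?_⟩)
        have h1 : ((coShapeVal j t.1 : ℕ) : ℤ) ∣ n := ⟨(c : ℤ) * ((t.2.2.2 : ℤ) ^ e - (t.2.1.2 : ℤ) ^ e),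
          by rw [← heq]; ring⟩
        have h2 : ((coShapeVal j t.1 : ℕ) : ℤ).natAbs ∣ n.natAbs := Int.natAbs_dvd_natAbs.mpr h1
        rwa [Int.natAbs_natCast] at h2)]
      calc ∑ r ∈ BRn, (F.filter (fun t => t.1 = r)).card
          ≤ ∑ r ∈ BRn, 2 * n.natAbs.divisors.card := by
            refine sum_le_sum fun r hr => ?_
            have hrBR : r ∈ BR := (mem_filter.mp hr).1
            have hK : (c : ℤ) * coShapeVal j r ≠ 0 := by
              have hrpos : ∀ i, 0 < r i := fun i => by
                have h := (mem_dyadicBox.mp hrBR) i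
                have hXi : 0 < j.removeNth X i := hX _
                omega
              have := coShapeVal_pos j hrpos
              positivity
            refine le_trans ?_ (card_pairs_pow_sub_pow_le he2 hK hn0 BS)
            refine card_le_card_of_injOn (fun t => (t.2.1.2, t.2.2.2)) (fun t ht => ?_)
              (fun t ht t' ht' h => ?_)
            · obtain ⟨htF, htr⟩ := mem_filter.mp (mem_coe.mp ht)
              obtain ⟨-, hs, hs', -, -, hne, heq⟩ := hFmem t htF
              rw [htr] at heq
              exact mem_coe.mpr (mem_filter.mpr ⟨mem_product.mpr ⟨hs, hs'⟩, hne, heq⟩)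
            · obtain ⟨htF, htr⟩ := mem_filter.mp (mem_coe.mp ht)
              obtain ⟨htF', htr'⟩ := mem_filter.mp (mem_coe.mp ht')
              obtain ⟨-, -, -, hty, hty', -, -⟩ := hFmem t htF
              obtain ⟨-, -, -, hty2, hty2', -, -⟩ := hFmem t' htF'
              simp only [Prod.mk.injEq] at h
              refine Prod.ext (htr.trans htr'.symm) (Prod.ext (Prod.ext ?_ h.1) (Prod.ext ?_ h.2))
              · rw [hty, hty2]
              · rw [hty', hty2']
        _ = BRn.card * (2 * n.natAbs.divisors.card) := by rw [sum_const, smul_eq_mul]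
        _ ≤ D ^ d' * (2 * D) := Nat.mul_le_mul hBRn (Nat.mul_le_mul_left 2 hnD)
        _ = 2 * D ^ (d' + 1) := by ring
  /- Step 5: assemble -/
  have hE2 : energy2 c X ≤ box.card * D ^ (d' + 1) := by
    refine energy2_le hc X (fun z hz => hD _ ?_ ?_) (fun z hz => ?_)
    · exact (shapeVal_pos fun i => lt_of_lt_of_le (hX i) ((mem_dyadicBox.mp hz) i).1).ne'
    · exact le_trans (Nat.le_mul_of_pos_left _ hc) (hval_le z hz)
    · exact (shapeVal_pos fun i => lt_of_lt_of_le (hX i) ((mem_dyadicBox.mp hz) i).1).ne'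
  have hsplit := card_filter_add_card_filter_not (s := NN) (fun t => t.2.1.2 = t.2.2.2)
  calc energy4 c X ≤ _ := h1
    _ ≤ BR.card * NN.card := h2
    _ = BR.card * ((NN.filter (fun t => t.2.1.2 = t.2.2.2)).card +
          (NN.filter (fun t => ¬ t.2.1.2 = t.2.2.2)).card) := by rw [hsplit]
    _ ≤ BR.card * (BR.card * BS.card * (box.card * D ^ (d' + 1)) +
          box.card ^ 2 * (2 * D ^ (d' + 1))) := by
        gcongr
        · exact h3.trans (Nat.mul_le_mul_left _ hE2)
    _ = 3 * D ^ (d' + 1) * box.card ^ 2 * BR.card := by rw [← hNsplit]; ring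
    _ = 3 * D ^ (d' + 1) * (dyadicBox X).card ^ 2 * ∏ i : Fin d', X (j.succAbove i) := by
        rw [hBRcard]

end AbcShapes

end Literature.NumberTheory.DiophantineGeometry
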